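import Summits.QuantumFields.BalabanUV.T4Continuum.Support.B13StepOfRecordSubstrateShiftBalabanRate

/-!
# B13StepOfRecordSubstrateShiftBalabanRateUniform — NE5 ∕ U3: the η-UNIFORM form of `B13StepOfRecordSubstrateShiftBalabanRate` (E8[rec] at the substrate's
# COV-SHIFTED O1 instance `slotsOfRecordShift …`, W1 produced ON THE RATE ROAD — row NE2's per-background `LocalRate` binder displayed, NO row NE3 input — via
# substrate-p1's W-21c `SubstrateO1ReadingsShiftRate`): ONE `C₅` FROM THE SIZES for EVERY driven two-run object, letter package, datum type and readings carrier;
# the twin of p237433 on the road of record after ruling R58, split from its companion for the 400-line rule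

Cell `pub-balaban`, unit `b2b-balaban-t4-ne5-formalise-leaf-01` (NE5 formalisation swarm, LEAF PROVER 01, gen 21; typer `t4/formal/NE5/LEAVES.md` v2.10
CLAIM RULE 7 (b)∕(e) ∕ CLAIM RULE 1; NE5 owner R58 `HOME/CLAIMS.log` l.22206, substrate-typer (ο7-2) ∕ (ο9-1), owner g38-c p239282; journal ONLINE+INTENT gen 21
l.22607).  GENERATED MECHANICALLY from the TREE bytes of p237433 by the same substitution table as its companion (generator `gen_rate2.py --uniform`): import
`B13StepOfRecordSubstrateShiftBalaban ↦ B13StepOfRecordSubstrateShiftBalabanRate`; opens re-pointed (`SubstrateO1ReadingsShiftRate (weightedEntrywiseRate_slotsOfRecordShift_balaban_rate)`,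
`T4EtaRateMin (Readings LocalRate)`, `+ NE2FromNE3 (bgReadings)`, `+ RegularBackgroundTower (regClass)`, `− NE2FromNE3Carrier`, `− MinimalActionRate`); the SIZE `hθ0 : 0 ≤ θ`
joins `hθ1 : θ < 1` OUTSIDE the `∃ C₅`; INSIDE the `∀`: the sorts `{BgD ιp Xp : Type*}`, `{dom : Set BgD}`, `{RgV : BgD → …}`, `{Rp : Readings ιp Xp}` replace
`{𝒞} {Nl} {dom} {RgV}` over unit-lattice driving data, the arrow `NE3Shape (minActReadings d 𝒞 L Nl dom (ne2Loc …)) C θ →` is REPLACED by `(∀ V ∈ dom, LocalRate (bgReadings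
L M (regClass L M (liftR L M (RgV V)))) C θ) → LocalRate Rp C θ →` (row NE2's ROOT-B binder per background + the abstract potential-readings carrier's rate — g38-c's
letters), `PotQLipschitzReading ∕ PotRLipschitzReading` read `Rp`; in the proof `intro … BgD ιp Xp dom RgV Rp …`, `hNE3 ↦ hloc hRp`, and the per-object W1 is W-21c's
`weightedEntrywiseRate_slotsOfRecordShift_balaban_rate … hC hθ0 hθ1 hloc hRp ha′ …`; every other byte UNCHANGED (`hΘ0 ∕ hΘ1` from `sqrt_rate_pos_lt_one L hL hθ1` as
before).  p237433 STAYS AS LANDED (true road; append-only).  Imports `B13StepOfRecordSubstrateShiftBalabanRate` ONLY (through it: `B13StepOfRecordSubstrateShift`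
§2 `uniform_ne5_of_substrateShift_restrict_secant_structural`, p225077 §1 `sqrt_rate_pos_lt_one` ∕ `c1_balaban_nonneg`, W-21c); edits nothing; defines nothing
(0 `def`); constructs ∕ discharges NOTHING of the substrate's instance (R34); no species reading defined (R41).  Summits-side new work under the LEAN PLACEMENT RULE
(bookkeeping BY NAME; no cite tags — printed KIND only).
HONEST FRAMING: rung (B)+1 of the FINITE-VOLUME T⁴ continuum programme — NOT infinite volume, NOT a mass gap, NOT the Clay problem, and **NOT A PROOF OF
NE5** (NOT PRINTED; cell GAPS G-t4-U3-1), NOT a proof of NE2: an IMPLICATION whose wall binders are DISPLAYED — row NE2's two-level-consistency binders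
`hloc` ∕ `hRp` (OPEN as displayed; for averaging towers of (α′,β′)-regular fields supplied by NE2's bridge `NE2FromNE3BavgBridge.localRate_regClass_of_bavg_consistent`
from `hreg` + `hlipD` + `γ` — NOT applied here), the (3.35)-class ∕ threshold letters, the owner's O1 reading ∕ decay ∕ Lipschitz ∕ domination letters AT THE
SUBSTRATE's TABLES (covariance readings WINDOWED, run B's cov slot one level deeper), the substrate's `SlotLetters`, the Letters module's letter conditions, W2-op
∕ W2-ins ∕ W3 ∕ L04–L06 ∕ the activity letters — asserted nowhere; W1 RELOCATED to `LocalRate` + letters, not discharged; NO row NE3 input (R58 (3′)).  R48 ∕ R49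
honest line and VALUE as in the companion module.  HONEST DEPENDENCY (cell line, verbatim): continuum YM on T⁴ ⇐ BetaPertH ∧ nine spine estimates (0/9 proved);
BetaPertH ⇐ (D1) ∧ (D4) ∧ CAP+tail; G-an2-4 gates asym, D1 and NE2/3/4.

* §2 **`uniform_ne5_of_substrateShift_restrict_secant_structural_balaban_rate`** — `∃ C₅, ∀ 𝔾 D ιr cc ag sg … Pm … 𝒵 domZ Jc Vv mI Lsl (letter conditions)
  (factorisation) BgD ιp Xp dom RgV Rp tow W σ … (every analytic binder), NE5 (outA (slotsOfRecordShift …) E₀ cB) (outB (slotsOfRecordShift …) E₀ cB) W κ θ′ C₅` —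
  `B13StepOfRecordSubstrateShift.uniform_ne5_of_substrateShift_restrict_secant_structural` (§2) at `c₁ :=` W1's assembled constant, `θ := √(max θ L⁻¹)`, with
  EVERY per-object hypothesis (`hreg hloc hRp hdec … hR`, the Letters module's letter conditions, its factorisation, the E8[rec] binders) INSIDE —
  the SIZES (incl. `Lsl.ins.ω = ω`, pinned inside by `hLω`; W1's constant letters `B₁ B₂ B₃ Λ₂ … Λ₅ C …`; the honest rate `0 ≤ θ < 1`) OUTSIDE.
  Conclusion per object LITERALLY `T4OutputRate.NE5 (B13StepOfRecord.outA (slotsOfRecordShift …) E₀ cB) (B13StepOfRecord.outB (slotsOfRecordShift …) E₀ cB) W κ θ′ C₅`.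
CENSUS vs p237433 §2 (binders, by name): outer PLUS = [hθ0], outer MINUS = ∅; inner MINUS = [𝒞, Nl, the arrow `NE3Shape …`]; inner PLUS = [BgD ιp Xp, Rp, the
arrows `∀ V ∈ dom, LocalRate …` ∕ `LocalRate Rp C θ`]; inner TYPE changes = `dom`, `RgV`, the two potential-Lipschitz arrows (read `Rp`); conclusion IDENTICAL.
Headline wording (trigger c5 ∕ referee INFO-38): «END ⇐ instance letters», never «leaf instantiated»; 0∕12 leaves on Bałaban's concrete objects; spine 0∕9.
`FlowStep.BetaPertH`, (B), (B^μ) do not occur.  0 sorry; axioms ⊆ {propext, Classical.choice, Quot.sound}.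
-/

noncomputable section

open scoped BigOperators ComplexConjugate Matrix Matrix.Norms.L2Operator Kronecker
open Metric Set MeasureTheory

namespace Summit.QuantumFields.BalabanUV.T4Continuum.B13StepOfRecordSubstrateShiftBalabanRateUniform

open Literature.MathematicalPhysics.QuantumFieldTheory.Balaban1983to89
open Literature.MathematicalPhysics.QuantumFieldTheory.Balaban1983to89.T4OutputRate (DecayBound NE5)
open Literature.MathematicalPhysics.QuantumFieldTheory.Balaban1983to89.T4InputCauchyRateSpecies (ballClass)
open Literature.MathematicalPhysics.QuantumFieldTheory.Balaban1983to89.B5Prop11Plancherel (Cst Cst_nonneg Tor fine)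
open Literature.MathematicalPhysics.QuantumFieldTheory.Balaban1983to89.B5G183RateUnitTower (lev lev_neZero)
open Literature.MathematicalPhysics.QuantumFieldTheory.Balaban1983to89.T4EtaRateMin (Readings LocalRate)
open Summit.QuantumFields.BalabanUV.T4Continuum
open Summit.QuantumFields.BalabanUV.T4Continuum.B13Carriers (TwoRuns)
open Summit.QuantumFields.BalabanUV.T4Continuum.B13OpDatum (OpDatum Species FormatBounded B13Weights)
open Summit.QuantumFields.BalabanUV.T4Continuum.B13OpDatumJunctions (opOf RawBounded WeightedEntrywiseRate)
open Summit.QuantumFields.BalabanUV.T4Continuum.B13OpMeasurable (measOp)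
open Summit.QuantumFields.BalabanUV.T4Continuum.B13HistMeasurable (MeasPotFrame B13HistM)
open Summit.QuantumFields.BalabanUV.T4Continuum.B13StepTermLabels (InnerLabel)
open Summit.QuantumFields.BalabanUV.T4Continuum.B13StepTermFamily (ActData ActExpLinearOn)
open Summit.QuantumFields.BalabanUV.T4Continuum.B13StepTermSocket (labelsIndexing)
open Summit.QuantumFields.BalabanUV.T4Continuum.B13InnerData (Bnd b13InnerData)
open Summit.QuantumFields.BalabanUV.T4Continuum.UrsellTermBudget (actSum)
open Summit.QuantumFields.BalabanUV.T4Continuum.B13TermHistSecant (ActExpNormBound ActAbsBound)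
open Summit.QuantumFields.BalabanUV.T4Continuum.B13DomainGeometryTR (domainGeometry)
open Summit.QuantumFields.BalabanUV.T4Continuum.B13Base (selfCtr)
open Summit.QuantumFields.BalabanUV.T4Continuum.B13StepOfRecord (Slots assembly step)
open Summit.QuantumFields.BalabanUV.T4Continuum.OutputRateActOpFibre (ActOpFibre)
open Summit.QuantumFields.BalabanUV.T4Continuum.OutputRateInsertionStructural (InsOpComposition)
open Summit.QuantumFields.BalabanUV.T4Continuum.B13StepOfRecordSub (assemblyOn stepOn restrict opA_mem_measOp opB_mem_measOp)
open Summit.QuantumFields.BalabanUV.T4Continuum.B13StepOfRecordSubstrateShiftLetters (opA_mem_measOp_slotsOfRecordShift opB_mem_measOp_slotsOfRecordShift)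
open Summit.QuantumFields.BalabanUV.T4Continuum.B13StepOfRecordSubstrateShift (ne5_of_substrateShift_restrict_secant_structural
  uniform_ne5_of_substrateShift_restrict_secant_structural)
open Summit.QuantumFields.BalabanUV.T4Continuum.B13StepEndInsOpBalaban (sqrt_rate_pos_lt_one c1_balaban_nonneg)
open Summit.QuantumFields.BalabanUV.T4Continuum.B13ReadingsDecay (CovWeightDominatesDist)
open Summit.QuantumFields.BalabanUV.T4Continuum.B13ReadingsLevelWindow (ReadsTowerCovAOn ReadsTowerCovBOn)
open Summit.QuantumFields.BalabanUV.T4Continuum.B13ReadingsImage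
open Summit.QuantumFields.BalabanUV.T4Continuum.B13ReadingsLocal (PotQLipschitzReading PotRLipschitzReading)
open Summit.QuantumFields.BalabanUV.T4Continuum.B13ReadingsAssembly (CpertRec)
open Summit.QuantumFields.BalabanUV.T4Continuum.SubstrateO1ReadingsShiftRate (weightedEntrywiseRate_slotsOfRecordShift_balaban_rate)
open Summit.QuantumFields.BalabanUV.T4Continuum.DecayRateInterpolation (EntryDecay)
open Summit.QuantumFields.BalabanUV.T4Continuum.CovariantBlockAveraging (ContourSystem)
open Summit.QuantumFields.BalabanUV.T4Continuum.SubstrateBackgroundTransporters (unitMod)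
open Summit.QuantumFields.BalabanUV.T4Continuum.SubstrateTwoRunsDriven (DrivenRuns)
open Summit.QuantumFields.BalabanUV.T4Continuum.SubstrateRawSpecies
open Summit.QuantumFields.BalabanUV.T4Continuum.SubstrateSlotsOfRecord
open Summit.QuantumFields.BalabanUV.T4Continuum.SubstrateSlotsOfRecordShift
open Summit.QuantumFields.BalabanUV.T4Continuum.BalabanAveragedTowerUnit (idx Qlev)
open Summit.QuantumFields.BalabanUV.T4Continuum.GaugeTermScalarData (QuT Q1)
open Summit.QuantumFields.BalabanUV.T4Continuum.RegularSiteTransporters (siteT)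
open Summit.QuantumFields.BalabanUV.T4Continuum.RegularBackgroundTower (RegularTransporters regClass)
open Summit.QuantumFields.BalabanUV.T4Continuum.NE2ColourPerturbedLayer (pertCovC)
open Summit.QuantumFields.BalabanUV.T4Continuum.NE2BalabanRoot (balabanPert)
open Summit.QuantumFields.BalabanUV.T4Continuum.NE2BalabanGauge (gaugeSlot liftR)
open Summit.QuantumFields.BalabanUV.T4Continuum.NE2BalabanThreshold (etaStar)
open Summit.QuantumFields.BalabanUV.T4Continuum.NE2FromNE3 (bgReadings)

/-! ## §2 One constant for every driven two-run object and every letter package (η-uniformity at the substrate's instance) -/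

section Uniform

variable {d : ℕ} (L : ℕ) [NeZero L] (M : Fin d → ℕ) [hM : ∀ μ, NeZero (M μ)] (a : ℝ) (ha : 0 < a)
variable {o : Type*} [Fintype o] [DecidableEq o] {α β C a' η : ℝ} {m : Type*} [Fintype m] [DecidableEq m]

/-- [folklore] **ONE CONSTANT FOR EVERY DRIVEN TWO-RUN OBJECT, EVERY LETTER PACKAGE, EVERY DATUM TYPE AND READINGS CARRIER (η-UNIFORMITY AT THE SUBSTRATE's
COV-SHIFTED O1 INSTANCE), W1 PRODUCED ON THE RATE ROAD, COVARIANCE READINGS WINDOWED** — `B13StepOfRecordSubstrateShift.uniform_ne5_of_substrateShift_restrict_secant_structural`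
(p219431 §2 at the shifted instance) with `c₁ :=` W1's assembled constant and `θ := √(max θ L⁻¹)` (both SIZES), its `hwer` binder supplied per two-run object,
letter package, datum type and readings carrier by substrate-p1's W-21c `weightedEntrywiseRate_slotsOfRecordShift_balaban_rate`, `hc₁ ∕ hθ0 ∕ hθ1` of the END by
p225077 §1.  Fix the SIZES (`κ Nbar ε εop Rt EA₀ E₀ cA cB r₀ Gi δI ρ₁ θ′ ω ρ₀ k₁`, W1's constant letters `o d L a α β C a′ B₁ B₂ B₃ Λ₂ … Λ₅`, the honest rate
`0 ≤ θ < 1`), subject to `√(max θ L⁻¹) ≤ θ′ ≤ 1`, the rooms and `hsmall`.  Then ONE `C₅` serves EVERY gauge group `𝔾`, driven two-run object `D : DrivenRuns 𝔾`,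
representation `ιr`, letters `cc ag sg`, frame `Pm`, insertion-operator sort `IOp`, factor index data `𝒵 domZ Jc Vv mI`, EVERY letter package `Lsl` with
`Lsl.ins.ω = ω` satisfying the Letters module's six letter conditions (`hbdB` about `rawBOfRecordShift D ιr …`) and its factorisation, EVERY datum type `BgD` with
admissible data `dom ∕ RgV` in the (3.35)-class whose averaging towers carry row NE2's two-level-consistency binder `∀ V ∈ dom, LocalRate (bgReadings L M (regClass L M
(liftR L M (RgV V)))) C θ`, EVERY potential-readings carrier `Rp : Readings ιp Xp` with `LocalRate Rp C θ`, towers over `D`'s run-B backgrounds, O1 letters at the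
substrate's tables (`hcovA ∕ hcovB` in g37-c's WINDOWED shapes `ReadsTowerCovAOn ∕ ReadsTowerCovBOn {k : ℕ | k ≤ D.K}`, run B's raw record shifted, `hQ ∕ hR` reading
`Rp`), window, radii, majorants, datum, insertion-composition data: the displayed binders IMPLY `NE5 (B13StepOfRecord.outA (slotsOfRecordShift …) E₀ cB)
(B13StepOfRecord.outB (slotsOfRecordShift …) E₀ cB) W κ θ′ C₅` — p237433 §2 with `NE3Shape (minActReadings …)` replaced by g38-c's rate letters, nothing else.  NOT a
proof of NE5 ∕ NE2: an implication from displayed binders, the quantifier order `∃ C₅, ∀ 𝔾 D … Lsl … BgD … Rp …` being the point; NO row NE3 input. -/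
theorem uniform_ne5_of_substrateShift_restrict_secant_structural_balaban_rate (hL : 2 ≤ L) (hd : 1 ≤ d) (hα : 0 ≤ α) (hβ : 0 ≤ β)
    (hC : 0 ≤ C) (ha' : 0 < a') (hαη : α ≤ η) (hβη : β ≤ η) (hη : η ≤ etaStar o d a a') {B₁ B₂ B₃ Λ₂ Λ₃ Λ₄ Λ₅ : ℝ}
    (hΛ₂ : 0 ≤ Λ₂) (hΛ₃ : 0 ≤ Λ₃) (hΛ₄ : 0 ≤ Λ₄) (hΛ₅ : 0 ≤ Λ₅) {θ : ℝ} (hθ0 : 0 ≤ θ) (hθ1 : θ < 1)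
    {κ Nbar ε εop Rt EA₀ E₀ cA cB r₀ Gi δI ρ₁ θ' ω ρ₀ : ℝ} {k₁ : ℕ}
    (hκ : 0 ≤ κ) (hNbar : 0 ≤ Nbar) (hε : 0 ≤ ε) (hεop : 0 ≤ εop) (hRt : 64 * Real.log 162 + 64 ≤ Rt)
    (hΦsmall : 36 * (ε * Real.exp 64 * B12TreeDecay.K₀ (4 * 2 ^ 4) (2 * 4)) < 1)
    (hΦopsmall : 36 * (εop * Real.exp 64 * B12TreeDecay.K₀ (4 * 2 ^ 4) (2 * 4)) < 1)
    (hEA₀ : 0 ≤ EA₀) (hE₀ : 0 ≤ E₀) (hcA : 0 ≤ cA) (hcB : 0 ≤ cB) (hr₀ : 0 < r₀)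
    (hGi : 0 ≤ Gi) (hδI : 0 ≤ δI) (hρ₁ : ρ₁ < 1) (hreachI : δI * Real.sqrt (max θ ((L : ℝ)⁻¹)) ^ k₁ ≤ ρ₁)
    (hθθ' : Real.sqrt (max θ ((L : ℝ)⁻¹)) ≤ θ') (hθ'1 : θ' ≤ 1) (hω : 0 < ω) (hω1 : ω < 1) (hρ₀ : 0 < ρ₀) (hρ₀1 : ρ₀ < 1)
    (hsmall : ω + 2 * (Nbar * ((ε * Real.exp 64 * B12TreeDecay.K₀ (4 * 2 ^ 4) (2 * 4)) /
          (1 - 36 * (ε * Real.exp 64 * B12TreeDecay.K₀ (4 * 2 ^ 4) (2 * 4))) ^ 2)) * cA < θ') :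
    ∃ C₅ : ℝ, ∀ {𝔾 : Type} [GaugeGroup 𝔾] (D : DrivenRuns 𝔾) {oc : Type} [Fintype oc] [DecidableEq oc] (ιr : 𝔾 →* Matrix oc oc ℂ) (cc : ℂ)
      (ag : ℝ) (sg : ℕ → ℂ) {T ι' Sy Ω 𝒴 : Type} [MeasurableSpace Ω] (Pm : MeasPotFrame D.carriers) {IOp : Type*} [NormedAddCommGroup IOp]
      [NormedSpace ℂ IOp] (𝒵 : D.carriers.Dom → InnerLabel D.carriers.Dom (Bnd D.toTwoRuns) → Type) [∀ Z j, Fintype (𝒵 Z j)]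
      (domZ : ∀ Z j, 𝒵 Z j → D.carriers.Dom) (Jc : D.carriers.Dom → InnerLabel D.carriers.Dom (Bnd D.toTwoRuns) → Type)
      [∀ Z j, Fintype (Jc Z j)] (Vv : D.carriers.Dom → InnerLabel D.carriers.Dom (Bnd D.toTwoRuns) → Type)
      [∀ Z j, NormedAddCommGroup (Vv Z j)] [∀ Z j, InnerProductSpace ℝ (Vv Z j)] [∀ Z j, MeasurableSpace (Vv Z j)] [∀ Z j, BorelSpace (Vv Z j)]
      [∀ Z j, FiniteDimensional ℝ (Vv Z j)] (mI : D.carriers.Dom → InnerLabel D.carriers.Dom (Bnd D.toTwoRuns) → Type)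
      [∀ Z j, Fintype (mI Z j)] [∀ Z j, DecidableEq (mI Z j)]
      (Lsl : SlotLetters D (o := oc) (T := T) (ι' := ι') (S := Sy) (Ω := Ω) (𝒴 := 𝒴) Pm (IOp := IOp) 𝒵 domZ Jc Vv mI)
      (hbdA : ∀ (g : ℕ → ℝ) (U : D.carriers.BgA) (k : ℕ),
        FormatBounded (Lsl.W k).format (rawAOfRecord ιr D cc ag sg Lsl.ΓA Lsl.dkA Lsl.gcA Lsl.pQA Lsl.pRA g U k).kernel)
      (hmQA : ∀ (r : ℝ) (U : GaugeField (D.F.P D.K) 0 𝔾) (k : ℕ) (Y : 𝒴) (b b' : ((Tor (unitMod (D.F.P D.K)) × Fin (D.F.P D.K).d) × oc)),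
        Measurable fun x : Ω => Lsl.pQA r U k x Y b b')
      (hmRA : ∀ (r : ℝ) (U : GaugeField (D.F.P D.K) 0 𝔾) (k : ℕ) (Y : 𝒴), Measurable fun x : Ω => Lsl.pRA r U k x Y)
      (hbdB : ∀ (g : ℕ → ℝ) (U : D.carriers.BgB) (k : ℕ),
        FormatBounded (Lsl.W k).format (rawBOfRecordShift D ιr cc ag sg Lsl.ΓB Lsl.dkB Lsl.gcB Lsl.pQB Lsl.pRB g U k).kernel)
      (hmQB : ∀ (r : ℝ) (U : GaugeField (D.F.P (D.K + 1)) 0 𝔾) (k : ℕ) (Y : 𝒴) (b b' : ((Tor (unitMod (D.F.P D.K)) × Fin (D.F.P D.K).d) × oc)),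
        Measurable fun x : Ω => Lsl.pQB r U k x Y b b')
      (hmRB : ∀ (r : ℝ) (U : GaugeField (D.F.P (D.K + 1)) 0 𝔾) (k : ℕ) (Y : 𝒴), Measurable fun x : Ω => Lsl.pRB r U k x Y)
      (iopAt : ℝ → D.carriers.BgA → ℕ → IOp)
      (hiopA : ∀ (r : ℝ) (U : D.carriers.BgB) (k : ℕ), Lsl.ins.iopA r U k = iopAt r (D.carriers.transport U) k)
      {BgD ιp Xp : Type*} {dom : Set BgD}
      {RgV : BgD → ((k : ℕ) → Fin d → (Tor (fine (lev L k) M) → Matrix o o ℂ))} {Rp : Readings ιp Xp}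
      {tow : ℕ → (ℕ → ℝ) → D.toTwoRuns.carriers.BgB → ↥dom} {W : Set (ℕ → ℝ)}
      {σ : T → ((Tor (unitMod (D.F.P D.K)) × Fin (D.F.P D.K).d) × oc) → idx L M 0 × o} {dist₁ : idx L M 0 × o → idx L M 0 × o → ℝ} {δ₁ : ℝ}
      {S₂ : Set (Matrix (idx L M 0 × o) (idx L M 0 × o) ℂ)} {Φ : T → Matrix (idx L M 0 × o) (idx L M 0 × o) ℂ → Matrix m m ℂ}
      {dist₂ : m → m → ℝ} {δ₂ : ℝ} {σX : T → ι' → m}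
      {S₃ : Set (Matrix (idx L M 0 × o) (idx L M 0 × o) ℂ)} {Ψ : T → Matrix (idx L M 0 × o) (idx L M 0 × o) ℂ → Matrix m m ℂ}
      {dist₃ : m → m → ℝ} {δ₃ : ℝ} {σB : T → ((Tor (unitMod (D.F.P D.K)) × Fin (D.F.P D.K).d) × oc) → m}
      {ROp RHist : ℕ → ℝ}
      {N A A' Aop Aop' : ℕ → (ℕ → ℝ) → D.toTwoRuns.carriers.BgB → D.toTwoRuns.carriers.Dom →
        InnerLabel D.toTwoRuns.carriers.Dom (Bnd D.toTwoRuns) → ℝ}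
      {Dt : ActData D.toTwoRuns.carriers.Dom (InnerLabel D.toTwoRuns.carriers.Dom (Bnd D.toTwoRuns))
        (measOp T ((Tor (unitMod (D.F.P D.K)) × Fin (D.F.P D.K).d) × oc) ι' Ω 𝒴) (B13HistM Pm) Ω} {rI : ℕ → ℝ} {hrI : ∀ k, 0 < rI k}
      {Cfg : ℕ → Type*} [∀ k, NormedAddCommGroup (Cfg k)] [∀ k, NormedSpace ℂ (Cfg k)] {cfg : ∀ k, IOp → Cfg k}
      {Φc : ∀ k, (D.toTwoRuns.carriers.Dom → ℝ) → Cfg k → B13HistM Pm} {𝒪 : ℕ → (ℕ → ℝ) → D.toTwoRuns.carriers.BgB → Set IOp}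
      {Dc : ∀ k, (ℕ → ℝ) → D.toTwoRuns.carriers.BgB → Set (Cfg k)},
      Lsl.ins.ω = ω →
      (∀ V ∈ dom, RegularTransporters L M (liftR L M (RgV V)) α β) →
      (∀ V ∈ dom, LocalRate (bgReadings L M (regClass L M (liftR L M (RgV V)))) C θ) → LocalRate Rp C θ →
      (∀ V ∈ dom, ∀ k, EntryDecay dist₁
        (pertCovC L M a ha (balabanPert L M a (liftR L M (RgV V)) (gaugeSlot L M (RgV V) (QuT L M o (siteT L M (RgV V))) (Q1 L M o) a'))
          1 k) B₁ δ₁) →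
      ReadsTowerCovAOn {k : ℕ | k ≤ D.K}
        (fun V : ↥dom => pertCovC L M a ha
          (balabanPert L M a (liftR L M (RgV V)) (gaugeSlot L M (RgV V) (QuT L M o (siteT L M (RgV V))) (Q1 L M o) a')) 1)
        σ tow (fun g U k => (rawAOfRecord ιr D cc ag sg Lsl.ΓA Lsl.dkA Lsl.gcA Lsl.pQA Lsl.pRA) g (D.toTwoRuns.carriers.transport U) k) W →
      ReadsTowerCovBOn {k : ℕ | k ≤ D.K}
        (fun V : ↥dom => pertCovC L M a ha
          (balabanPert L M a (liftR L M (RgV V)) (gaugeSlot L M (RgV V) (QuT L M o (siteT L M (RgV V))) (Q1 L M o) a')) 1)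
        σ tow (rawBOfRecordShift D ιr cc ag sg Lsl.ΓB Lsl.dkB Lsl.gcB Lsl.pQB Lsl.pRB) W →
      CovWeightDominatesDist (slotsOfRecordShift D ιr cc ag sg Pm 𝒵 domZ Jc Vv mI Lsl).F dist₁ σ (δ₁ / 2) →
      (∀ t, OpLipschitzOn S₂ (Φ t) Λ₂) →
      (∀ V ∈ dom, ∀ k, pertCovC L M a ha
        (balabanPert L M a (liftR L M (RgV V)) (gaugeSlot L M (RgV V) (QuT L M o (siteT L M (RgV V))) (Q1 L M o) a')) 1 k ∈ S₂) →
      (∀ V ∈ dom, ∀ t k, EntryDecay dist₂ (Φ t (pertCovC L M a ha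
        (balabanPert L M a (liftR L M (RgV V)) (gaugeSlot L M (RgV V) (QuT L M o (siteT L M (RgV V))) (Q1 L M o) a')) 1 k)) B₂ δ₂) →
      ReadsTowerDeltaA (fun (V : ↥dom) t k => Φ t (pertCovC L M a ha
        (balabanPert L M a (liftR L M (RgV V)) (gaugeSlot L M (RgV V) (QuT L M o (siteT L M (RgV V))) (Q1 L M o) a')) 1 k))
        σX tow (fun g U k => (rawAOfRecord ιr D cc ag sg Lsl.ΓA Lsl.dkA Lsl.gcA Lsl.pQA Lsl.pRA) g (D.toTwoRuns.carriers.transport U) k) W →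
      ReadsTowerDeltaB (fun (V : ↥dom) t k => Φ t (pertCovC L M a ha
        (balabanPert L M a (liftR L M (RgV V)) (gaugeSlot L M (RgV V) (QuT L M o (siteT L M (RgV V))) (Q1 L M o) a')) 1 k))
        σX tow (rawBOfRecordShift D ιr cc ag sg Lsl.ΓB Lsl.dkB Lsl.gcB Lsl.pQB Lsl.pRB) W →
      DeltaWeightDominatesDist (slotsOfRecordShift D ιr cc ag sg Pm 𝒵 domZ Jc Vv mI Lsl).F dist₂ σX (δ₂ / 2) →
      (∀ t, OpLipschitzOn S₃ (Ψ t) Λ₃) →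
      (∀ V ∈ dom, ∀ k, pertCovC L M a ha
        (balabanPert L M a (liftR L M (RgV V)) (gaugeSlot L M (RgV V) (QuT L M o (siteT L M (RgV V))) (Q1 L M o) a')) 1 k ∈ S₃) →
      (∀ V ∈ dom, ∀ t k, EntryDecay dist₃ (Ψ t (pertCovC L M a ha
        (balabanPert L M a (liftR L M (RgV V)) (gaugeSlot L M (RgV V) (QuT L M o (siteT L M (RgV V))) (Q1 L M o) a')) 1 k)) B₃ δ₃) →
      ReadsTowerGammaA (fun (V : ↥dom) t k => Ψ t (pertCovC L M a ha
        (balabanPert L M a (liftR L M (RgV V)) (gaugeSlot L M (RgV V) (QuT L M o (siteT L M (RgV V))) (Q1 L M o) a')) 1 k))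
        σB σX tow (fun g U k => (rawAOfRecord ιr D cc ag sg Lsl.ΓA Lsl.dkA Lsl.gcA Lsl.pQA Lsl.pRA) g (D.toTwoRuns.carriers.transport U) k) W →
      ReadsTowerGammaB (fun (V : ↥dom) t k => Ψ t (pertCovC L M a ha
        (balabanPert L M a (liftR L M (RgV V)) (gaugeSlot L M (RgV V) (QuT L M o (siteT L M (RgV V))) (Q1 L M o) a')) 1 k))
        σB σX tow (rawBOfRecordShift D ιr cc ag sg Lsl.ΓB Lsl.dkB Lsl.gcB Lsl.pQB Lsl.pRB) W →
      GammaWeightDominatesDist (slotsOfRecordShift D ιr cc ag sg Pm 𝒵 domZ Jc Vv mI Lsl).F dist₃ σB σX (δ₃ / 2) →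
      PotQLipschitzReading Rp (slotsOfRecordShift D ιr cc ag sg Pm 𝒵 domZ Jc Vv mI Lsl).F
        (fun g U k => (rawAOfRecord ιr D cc ag sg Lsl.ΓA Lsl.dkA Lsl.gcA Lsl.pQA Lsl.pRA) g (D.toTwoRuns.carriers.transport U) k)
        (rawBOfRecordShift D ιr cc ag sg Lsl.ΓB Lsl.dkB Lsl.gcB Lsl.pQB Lsl.pRB) W Λ₄ →
      PotRLipschitzReading Rp (slotsOfRecordShift D ιr cc ag sg Pm 𝒵 domZ Jc Vv mI Lsl).F
        (fun g U k => (rawAOfRecord ιr D cc ag sg Lsl.ΓA Lsl.dkA Lsl.gcA Lsl.pQA Lsl.pRA) g (D.toTwoRuns.carriers.transport U) k)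
        (rawBOfRecordShift D ιr cc ag sg Lsl.ΓB Lsl.dkB Lsl.gcB Lsl.pQB Lsl.pRB) W Λ₅ →
      (assembly (slotsOfRecordShift D ιr cc ag sg Pm 𝒵 domZ Jc Vv mI Lsl)).SliceBudgetB W κ cB →
      (slotsOfRecordShift D ιr cc ag sg Pm 𝒵 domZ Jc Vv mI Lsl).D.SliceBudget (step (slotsOfRecordShift D ιr cc ag sg Pm 𝒵 domZ Jc Vv mI Lsl) E₀ cB) W κ cA →
      DecayBound (B13StepOfRecord.outA (slotsOfRecordShift D ιr cc ag sg Pm 𝒵 domZ Jc Vv mI Lsl) E₀ cB) W EA₀ κ →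
      DecayBound (B13StepOfRecord.outB (slotsOfRecordShift D ιr cc ag sg Pm 𝒵 domZ Jc Vv mI Lsl) E₀ cB) W E₀ κ →
      RawBounded (slotsOfRecordShift D ιr cc ag sg Pm 𝒵 domZ Jc Vv mI Lsl).F (assembly (slotsOfRecordShift D ιr cc ag sg Pm 𝒵 domZ Jc Vv mI Lsl)).rawAt W →
      RawBounded (slotsOfRecordShift D ιr cc ag sg Pm 𝒵 domZ Jc Vv mI Lsl).F (slotsOfRecordShift D ιr cc ag sg Pm 𝒵 domZ Jc Vv mI Lsl).rawB W →
      (∀ k, r₀ ≤ Lsl.rOp k) →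
      InsOpComposition ((slotsOfRecordShift D ιr cc ag sg Pm 𝒵 domZ Jc Vv mI Lsl).D.toInsOpModel (step (slotsOfRecordShift D ιr cc ag sg Pm 𝒵 domZ Jc Vv mI Lsl) E₀ cB) rI hrI)
          W κ E₀ Gi cfg Φc 𝒪 Dc →
      (∀ k, ∀ g ∈ W, ∀ (U : D.toTwoRuns.carriers.BgB),
        ((slotsOfRecordShift D ιr cc ag sg Pm 𝒵 domZ Jc Vv mI Lsl).D.toInsOpModel (step (slotsOfRecordShift D ιr cc ag sg Pm 𝒵 domZ Jc Vv mI Lsl) E₀ cB)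
          rI hrI).opIA g U k ∈ 𝒪 k g U) →
      ((slotsOfRecordShift D ιr cc ag sg Pm 𝒵 domZ Jc Vv mI Lsl).D.toInsOpModel (step (slotsOfRecordShift D ιr cc ag sg Pm 𝒵 domZ Jc Vv mI Lsl) E₀ cB) rI hrI).InsOpRate W δI (Real.sqrt (max θ ((L : ℝ)⁻¹))) →
      ActOpFibre (labelsIndexing (domainGeometry D.toTwoRuns) (b13InnerData D.toTwoRuns))
        (restrict (slotsOfRecordShift D ιr cc ag sg Pm 𝒵 domZ Jc Vv mI Lsl) (measOp T ((Tor (unitMod (D.F.P D.K)) × Fin (D.F.P D.K).d) × oc) ι' Ω 𝒴)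
          (opA_mem_measOp_slotsOfRecordShift D ιr cc ag sg Pm 𝒵 domZ Jc Vv mI Lsl hbdA hmQA hmRA) (opB_mem_measOp_slotsOfRecordShift D ιr cc ag sg Pm 𝒵 domZ Jc Vv mI Lsl hbdB
            hmQB hmRB)).act
        (stepOn (restrict (slotsOfRecordShift D ιr cc ag sg Pm 𝒵 domZ Jc Vv mI Lsl) (measOp T ((Tor (unitMod (D.F.P D.K)) × Fin (D.F.P D.K).d) × oc) ι' Ω 𝒴)
          (opA_mem_measOp_slotsOfRecordShift D ιr cc ag sg Pm 𝒵 domZ Jc Vv mI Lsl hbdA hmQA hmRA) (opB_mem_measOp_slotsOfRecordShift D ιr cc ag sg Pm 𝒵 domZ Jc Vv mI Lsl hbdB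
            hmQB hmRB)) E₀ cB) W Aop →
      (∀ k g U Z ℓ, 0 ≤ Aop k g U Z ℓ) → (∀ k g U Z ℓ, 0 ≤ Aop' k g U Z ℓ) →
      (∀ k g U Z ℓ, Aop k g U Z ℓ ≤ Aop' k g U Z ℓ * Real.exp (-(κ * (D.toTwoRuns.carriers.d Z + 5)))) →
      (∀ k, ∀ g ∈ W, ∀ (U : D.toTwoRuns.carriers.BgB), ∀ Z ∈ D.toTwoRuns.domAt k,
        actSum (b13InnerData D.toTwoRuns) (Aop' k g U) k Z ≤ εop * Real.exp (-(Rt * D.toTwoRuns.carriers.d Z))) →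
      ActExpLinearOn (labelsIndexing (domainGeometry D.toTwoRuns) (b13InnerData D.toTwoRuns))
        (restrict (slotsOfRecordShift D ιr cc ag sg Pm 𝒵 domZ Jc Vv mI Lsl) (measOp T ((Tor (unitMod (D.F.P D.K)) × Fin (D.F.P D.K).d) × oc) ι' Ω 𝒴)
          (opA_mem_measOp_slotsOfRecordShift D ιr cc ag sg Pm 𝒵 domZ Jc Vv mI Lsl hbdA hmQA hmRA) (opB_mem_measOp_slotsOfRecordShift D ιr cc ag sg Pm 𝒵 domZ Jc Vv mI Lsl hbdB
            hmQB hmRB)).act Dt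
        (ballClass (selfCtr
          (assemblyOn (restrict (slotsOfRecordShift D ιr cc ag sg Pm 𝒵 domZ Jc Vv mI Lsl) (measOp T ((Tor (unitMod (D.F.P D.K)) × Fin (D.F.P D.K).d) × oc) ι' Ω 𝒴)
            (opA_mem_measOp_slotsOfRecordShift D ιr cc ag sg Pm 𝒵 domZ Jc Vv mI Lsl hbdA hmQA hmRA) (opB_mem_measOp_slotsOfRecordShift D ιr cc ag sg Pm 𝒵 domZ Jc Vv mI Lsl hbdB
              hmQB hmRB))).raw
          (assemblyOn (restrict (slotsOfRecordShift D ιr cc ag sg Pm 𝒵 domZ Jc Vv mI Lsl) (measOp T ((Tor (unitMod (D.F.P D.K)) × Fin (D.F.P D.K).d) × oc) ι' Ω 𝒴)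
            (opA_mem_measOp_slotsOfRecordShift D ιr cc ag sg Pm 𝒵 domZ Jc Vv mI Lsl hbdA hmQA hmRA) (opB_mem_measOp_slotsOfRecordShift D ιr cc ag sg Pm 𝒵 domZ Jc Vv mI Lsl hbdB
              hmQB hmRB))).histRef) ROp RHist) W →
      ActExpNormBound (labelsIndexing (domainGeometry D.toTwoRuns) (b13InnerData D.toTwoRuns)) Dt
        (ballClass (selfCtr
          (assemblyOn (restrict (slotsOfRecordShift D ιr cc ag sg Pm 𝒵 domZ Jc Vv mI Lsl) (measOp T ((Tor (unitMod (D.F.P D.K)) × Fin (D.F.P D.K).d) × oc) ι' Ω 𝒴)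
            (opA_mem_measOp_slotsOfRecordShift D ιr cc ag sg Pm 𝒵 domZ Jc Vv mI Lsl hbdA hmQA hmRA) (opB_mem_measOp_slotsOfRecordShift D ιr cc ag sg Pm 𝒵 domZ Jc Vv mI Lsl hbdB
              hmQB hmRB))).raw
          (assemblyOn (restrict (slotsOfRecordShift D ιr cc ag sg Pm 𝒵 domZ Jc Vv mI Lsl) (measOp T ((Tor (unitMod (D.F.P D.K)) × Fin (D.F.P D.K).d) × oc) ι' Ω 𝒴)
            (opA_mem_measOp_slotsOfRecordShift D ιr cc ag sg Pm 𝒵 domZ Jc Vv mI Lsl hbdA hmQA hmRA) (opB_mem_measOp_slotsOfRecordShift D ιr cc ag sg Pm 𝒵 domZ Jc Vv mI Lsl hbdB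
              hmQB hmRB))).histRef) ROp RHist) W
        Lsl.rHist N →
      (∀ k g U Z ℓ, 0 ≤ N k g U Z ℓ) → (∀ k g U Z ℓ, N k g U Z ℓ ≤ Nbar) →
      ActAbsBound (labelsIndexing (domainGeometry D.toTwoRuns) (b13InnerData D.toTwoRuns)) Dt
        (ballClass (selfCtr
          (assemblyOn (restrict (slotsOfRecordShift D ιr cc ag sg Pm 𝒵 domZ Jc Vv mI Lsl) (measOp T ((Tor (unitMod (D.F.P D.K)) × Fin (D.F.P D.K).d) × oc) ι' Ω 𝒴)
            (opA_mem_measOp_slotsOfRecordShift D ιr cc ag sg Pm 𝒵 domZ Jc Vv mI Lsl hbdA hmQA hmRA) (opB_mem_measOp_slotsOfRecordShift D ιr cc ag sg Pm 𝒵 domZ Jc Vv mI Lsl hbdB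
              hmQB hmRB))).raw
          (assemblyOn (restrict (slotsOfRecordShift D ιr cc ag sg Pm 𝒵 domZ Jc Vv mI Lsl) (measOp T ((Tor (unitMod (D.F.P D.K)) × Fin (D.F.P D.K).d) × oc) ι' Ω 𝒴)
            (opA_mem_measOp_slotsOfRecordShift D ιr cc ag sg Pm 𝒵 domZ Jc Vv mI Lsl hbdA hmQA hmRA) (opB_mem_measOp_slotsOfRecordShift D ιr cc ag sg Pm 𝒵 domZ Jc Vv mI Lsl hbdB
              hmQB hmRB))).histRef) ROp RHist) W A →
      (∀ k g U Z ℓ, 0 ≤ A k g U Z ℓ) → (∀ k g U Z ℓ, 0 ≤ A' k g U Z ℓ) →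
      (∀ k g U Z ℓ, A k g U Z ℓ ≤ A' k g U Z ℓ * Real.exp (-(κ * (D.toTwoRuns.carriers.d Z + 5)))) →
      (∀ k, ∀ g ∈ W, ∀ (U : D.toTwoRuns.carriers.BgB), ∀ Z ∈ D.toTwoRuns.domAt k,
        actSum (b13InnerData D.toTwoRuns) (A' k g U) k Z ≤ ε * Real.exp (-(Rt * D.toTwoRuns.carriers.d Z))) →
      (∀ k, (Real.sqrt (2 * B₁ * (2 * CpertRec o d L a α β C a' / (1 - max θ ((L : ℝ)⁻¹)))) +
          Real.sqrt (2 * B₂ * (Λ₂ * CpertRec o d L a α β C a')) + Real.sqrt (2 * B₃ * (Λ₃ * CpertRec o d L a α β C a')) +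
          Λ₄ * C + Λ₅ * C) / r₀ * Lsl.rOp k ≤ ROp k) → (∀ k, (assembly (slotsOfRecordShift D ιr cc ag sg Pm 𝒵 domZ Jc Vv mI Lsl)).bHist E₀ cB k ≤ RHist k) →
      (∀ k, (Gi * δI / (1 - ρ₁) + 2 * Gi / Real.sqrt (max θ ((L : ℝ)⁻¹)) ^ k₁) * Lsl.rHist k + EA₀ * (Lsl.rHist k * (cA / (1 - ω))) ≤ RHist k) →
      NE5 (B13StepOfRecord.outA (slotsOfRecordShift D ιr cc ag sg Pm 𝒵 domZ Jc Vv mI Lsl) E₀ cB)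
        (B13StepOfRecord.outB (slotsOfRecordShift D ιr cc ag sg Pm 𝒵 domZ Jc Vv mI Lsl) E₀ cB) W κ θ' C₅ := by
  obtain ⟨hΘ0, hΘ1⟩ := sqrt_rate_pos_lt_one L hL hθ1
  obtain ⟨C₅, h⟩ := uniform_ne5_of_substrateShift_restrict_secant_structural (k₁ := k₁) (κ := κ)
    (c₁ := (Real.sqrt (2 * B₁ * (2 * CpertRec o d L a α β C a' / (1 - max θ ((L : ℝ)⁻¹)))) + Real.sqrt (2 * B₂ * (Λ₂ * CpertRec o d L a α β C a')) + Real.sqrt (2 * B₃ * (Λ₃ * CpertRec o d L a α β C a')) + Λ₄ * C + Λ₅ * C))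
    hκ hNbar hε hεop hRt hΦsmall hΦopsmall hEA₀ hE₀ hcA hcB (c1_balaban_nonneg L a hC hΛ₄ hΛ₅) hr₀ hGi hδI hρ₁ hreachI hΘ0 hΘ1 hθθ' hθ'1
    hω hω1 hρ₀ hρ₀1 hsmall
  refine ⟨C₅, ?_⟩
  intro 𝔾 _ D oc _ _ ιr cc ag sg T ι' Sy Ω 𝒴 _ Pm IOp _ _ 𝒵 _ domZ Jc _ Vv _ _ _ _ _ mI _ _ Lsl hbdA hmQA hmRA hbdB hmQB hmRB iopAt hiopA BgD ιp Xp dom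
    RgV Rp tow W σ dist₁ δ₁ S₂ Φ dist₂ δ₂ σX S₃ Ψ dist₃ δ₃ σB ROp RHist N A A' Aop Aop' Dt rI hrI Cfg _ _ cfg Φc 𝒪 Dc hLω hreg hloc hRp hdec hcovA
    hcovB hdom₁ hΦ hS₂ hdecΦ hΔA hΔB hdom₂ hΨ hS₃ hdecΨ hΓA hΓB hdom₃ hQ hR hbB hbA hdA hdB hRA hRB hfl hcomp hIA hirate hfib hAop0 hAop0'
    hdecop h238op hexp hN hN0 hNle habs hA0 hA0' hdecAct h238 hOp hHist hHistA
  exact h D ιr cc ag sg Pm 𝒵 domZ Jc Vv mI Lsl hbdA hmQA hmRA hbdB hmQB hmRB iopAt hiopA hLω hbB hbA hdA hdB hRA hRB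
    (weightedEntrywiseRate_slotsOfRecordShift_balaban_rate D ιr cc ag sg Pm 𝒵 domZ Jc Vv mI Lsl L M a ha hL hd hreg hα hβ hC hθ0 hθ1 hloc hRp ha'
      hαη hβη hη hdec hcovA hcovB hdom₁ hΦ hΛ₂ hS₂ hdecΦ hΔA hΔB hdom₂ hΨ hΛ₃ hS₃ hdecΨ hΓA hΓB hdom₃ hΛ₄ hΛ₅ hQ hR)
    hfl hcomp hIA hirate hfib hAop0 hAop0' hdecop h238op hexp hN hN0 hNle habs hA0 hA0' hdecAct h238 hOp hHist hHistA

end Uniform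

end Summit.QuantumFields.BalabanUV.T4Continuum.B13StepOfRecordSubstrateShiftBalabanRateUniform

end
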